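import Summits.Ventures.PercRepro.ProfilePointedSeries
import Summits.Ventures.PercRepro.ProfilePointedBibasis

/-!
# PercRepro — (C1′) FOR EVERY MATROID OF NULLITY AT MOST 2, AT EVERY POINT
(p10, gen 17; `proofs/P10-AVFULL.md` §25(g))

For a finite matroid `M` on `N = #E` elements of rank `ρ`, nullity `η = N − ρ`, and a point `p`, the coloop limit
(C1′) `N · Σ_k κ_k ≤ 2 · Σ_k k · κ_k` (the body of `CapLimit`) is a theorem at a parallel pair
(`capLimit_body_parallel`, gen 16) and in the `p`-girth regime «every circuit through `p` has at least `η + 1`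
elements» (`capLimit_body_of_pGirth`, gen 16).  When `η ≤ 2` these two cases are exhaustive: a loop `p` captures
nothing (`capSets_eq_empty_of_loop`), a non-loop `p` either has a parallel partner or lies on no circuit of size ≤ 2,
i.e. its girth is at least `3 ≥ η + 1`.  Hence **(C1′) holds for every matroid of nullity at most 2 at every point**
(`capLimit_body_of_nullity_le_two`).  For nullity 3 the same argument covers every point on no triangle
(`capLimit_body_of_nullity_le_three_of_no_triangle`).  With `N ≥ 2ρ ⟹ Φ = 0` (ProfilePointedBibasis) this gives
(C1′) outside the window `ρ + 3 ≤ N ≤ 2ρ − 1` (`capLimit_body_of_nullity_le_two_or_two_mul_rk_le`) and hence **on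
every matroid with at most 6 elements** (`capLimit_body_of_card_le_six`: `η ≥ 3` forces `ρ ≤ 3 ≤ η`, i.e. `N ≥ 2ρ`);
the coverage census of §25(g) shows that on 7 and 8 elements the points NOT covered by the tree theorems are exactly
the connected nullity-3 instances with a triangle through `p`.  Nothing here asserts (C1′) in general.
-/

open scoped Matroid

namespace PercRepro.Cogirth

open Finset ThmH Skew

variable {α : Type} [DecidableEq α] {M : Matroid α} [M.Finite]

/-- A loop captures nothing: the complement of a captured set would contain the loop. -/
theorem capSets_eq_empty_of_loop {p : α} (hp : p ∈ gr M) (h0 : rk M {p} = 0) : capSets M p = ∅ := by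
  rw [eq_empty_iff_forall_notMem]
  intro X hX
  obtain ⟨⟨hXb, hpX⟩, -⟩ := mem_capSets.1 hX
  obtain ⟨_, -, hXc⟩ := mem_biIndepAll.1 hXb
  have h1 : rk M {p} = ({p} : Finset α).card :=
    rk_eq_card_of_subset_of_rk_eq_card (singleton_subset_iff.2 (mem_sdiff.2 ⟨hp, hpX⟩)) hXc
  rw [card_singleton] at h1
  omega

/-- (C1′) at a loop, trivially (`𝒦 = ∅`). -/
theorem capLimit_body_of_loop {p : α} (hp : p ∈ gr M) (h0 : rk M {p} = 0) :
    (gr M).card * ∑ k ∈ range ((gr M).card + 1), capCount M k p ≤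
      2 * ∑ k ∈ range ((gr M).card + 1), k * capCount M k p := by
  rw [capLimit_body_iff_sum_nonneg, capSets_eq_empty_of_loop hp h0, sum_empty]

/-- A non-loop `p` with no parallel partner has girth at least 3: every set `T ⊆ E − p` spanning `p` has at least
two elements. -/
theorem two_le_card_of_mem_clF_of_no_parallel {p : α} (hp : p ∈ gr M) (hp1 : rk M {p} = 1)
    (hpar : ¬ ∃ e ∈ gr M, e ≠ p ∧ rk M {e} = 1 ∧ rk M {p, e} = 1)
    {T : Finset α} (hT : T ⊆ (gr M).erase p) (hpT : p ∈ clF M T) : 2 ≤ T.card := by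
  by_contra hlt
  have hlt' : T.card ≤ 1 := by omega
  have hTg : T ⊆ gr M := hT.trans (erase_subset _ _)
  rw [mem_clF_iff_rk_insert_eq hp hTg] at hpT
  rcases Nat.lt_or_ge T.card 1 with h0 | h1
  · -- `T = ∅`: `p` would be a loop
    have hT0 : T = ∅ := card_eq_zero.1 (by omega)
    rw [hT0] at hpT
    have h2 := rk_le_card (M := M) ∅
    rw [card_empty] at h2
    rw [insert_empty] at hpT
    omega
  · -- `T = {e}`: `e` would be a parallel partner
    obtain ⟨e, hTe⟩ := card_eq_one.1 (by omega : T.card = 1)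
    rw [hTe] at hpT hT
    have he : e ∈ (gr M).erase p := singleton_subset_iff.1 hT
    rw [mem_erase] at he
    have hpe : rk M {p, e} = 1 := by
      have h2 : rk M {p} ≤ rk M {p, e} := rk_mono' (singleton_subset_iff.2 (mem_insert_self p {e}))
      have h3 := rk_le_card (M := M) {e}
      rw [card_singleton] at h3
      rw [show insert p ({e} : Finset α) = {p, e} from rfl] at hpT
      omega
    have he1 : rk M {e} = 1 := by
      have h3 := rk_le_card (M := M) {e}
      rw [card_singleton] at h3
      rw [show insert p ({e} : Finset α) = {p, e} from rfl] at hpT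
      omega
    exact hpar ⟨e, he.2, he.1, he1, hpe⟩

/-- **(C1′) FOR NULLITY AT MOST 2, AT EVERY POINT**: if `#E ≤ rk E + 2` then the body of `CapLimit` holds at every
`p ∈ E` — a loop captures nothing, a parallel pair is the gen-16 equality, and otherwise the girth through `p` is
at least `3 ≥ η + 1` (the `p`-girth regime). -/
theorem capLimit_body_of_nullity_le_two {p : α} (hp : p ∈ gr M) (h : (gr M).card ≤ rk M (gr M) + 2) :
    (gr M).card * ∑ k ∈ range ((gr M).card + 1), capCount M k p ≤
      2 * ∑ k ∈ range ((gr M).card + 1), k * capCount M k p := by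
  have hp1' := rk_le_card (M := M) {p}
  rw [card_singleton] at hp1'
  rcases Nat.eq_zero_or_pos (rk M {p}) with h0 | hpos
  · exact capLimit_body_of_loop hp h0
  have hp1 : rk M {p} = 1 := by omega
  by_cases hpar : ∃ e ∈ gr M, e ≠ p ∧ rk M {e} = 1 ∧ rk M {p, e} = 1
  · obtain ⟨e, he, hep, he1, hpe⟩ := hpar
    exact le_of_eq (capLimit_body_parallel hp he (Ne.symm hep) hp1 he1 hpe)
  · refine capLimit_body_of_pGirth hp (g := 3) ?_ (by omega)
    intro T hT hpT
    have := two_le_card_of_mem_clF_of_no_parallel hp hp1 hpar hT hpT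
    omega

/-- **(C1′) FOR NULLITY AT MOST 3 AT EVERY POINT ON NO TRIANGLE**: if `#E ≤ rk E + 3` and no set of at most two
elements of `E − p` spans `p`, the body of `CapLimit` holds at `p` (the `p`-girth regime with `g = 4`). -/
theorem capLimit_body_of_nullity_le_three_of_no_triangle {p : α} (hp : p ∈ gr M)
    (h : (gr M).card ≤ rk M (gr M) + 3)
    (htri : ∀ T ⊆ (gr M).erase p, T.card ≤ 2 → p ∉ clF M T) :
    (gr M).card * ∑ k ∈ range ((gr M).card + 1), capCount M k p ≤
      2 * ∑ k ∈ range ((gr M).card + 1), k * capCount M k p := by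
  refine capLimit_body_of_pGirth hp (g := 4) ?_ (by omega)
  intro T hT hpT
  by_contra hlt
  exact htri T hT (by omega) hpT

/-- **(C1′) OUTSIDE THE WINDOW `ρ + 3 ≤ N ≤ 2ρ − 1`**: nullity at most 2, or at least as many elements as twice the
rank. -/
theorem capLimit_body_of_nullity_le_two_or_two_mul_rk_le {p : α} (hp : p ∈ gr M)
    (h : (gr M).card ≤ rk M (gr M) + 2 ∨ 2 * rk M (gr M) ≤ (gr M).card) :
    (gr M).card * ∑ k ∈ range ((gr M).card + 1), capCount M k p ≤
      2 * ∑ k ∈ range ((gr M).card + 1), k * capCount M k p := by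
  rcases h with h | h
  · exact capLimit_body_of_nullity_le_two hp h
  · exact capLimit_body_of_two_mul_rk_le p h

/-- **(C1′) ON EVERY MATROID WITH AT MOST 6 ELEMENTS, AT EVERY POINT**: if `η ≥ 3` then `ρ ≤ N − 3 ≤ 3 ≤ η`, so
`N ≥ 2ρ`. -/
theorem capLimit_body_of_card_le_six {p : α} (hp : p ∈ gr M) (h : (gr M).card ≤ 6) :
    (gr M).card * ∑ k ∈ range ((gr M).card + 1), capCount M k p ≤
      2 * ∑ k ∈ range ((gr M).card + 1), k * capCount M k p := by
  apply capLimit_body_of_nullity_le_two_or_two_mul_rk_le hp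
  omega

end PercRepro.Cogirth
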